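import Summits.ABC.ABC.Theorems.DefiniteXiFreyModularityStubAbsIrrNegThree
import Literature.NumberTheory.EllipticCurves.SupersingularDensitySerreTraceProofs
import Literature.NumberTheory.EllipticCurves.ModPIrreducibleCongruenceTransferProofs
import Literature.NumberTheory.Automorphic.CDTTheorem722
import Literature.NumberTheory.GaloisRepresentations.AdequateSubgroup
import Literature.NumberTheory.GaloisRepresentations.ChebotarevOpenSubgroup
import Mathlib.LinearAlgebra.Trace
import HarnessLib

/-!
# `stub_liftThree` — ideator k3 (GEN 4), HOME FAMILY 3 "probe the extremes": typed companion

Extends (does not repeat) the k3 companions of gens 2–3 (`STUB_IDEAS_stub_liftThree_3.lean`,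
`…_3_Instances.lean`, `…_3g3.lean`: E1–E8).  See `STUB-IDEAS-stub_liftThree-3.md` (gen 4).
Crux `FreyModularity` (item `stmt-ABC-11340`), line `Lines/Sketch.lean`, stub

  `stub_liftThree : ∀ W [IsElliptic] ρ, W.IsTorsionGaloisRep 3 ρ → ρ.IsAbsIrreducibleOverSqrt (-3) →
     ¬ 9 ∣ N_W → ρ.IsModular → W.IsModularGaloisRepTate 3`.

GEN-4 LEVER: `ℓ = 3` is the EXTREME prime of the Taylor–Wiles method.  Every place where
Darmon–Diamond–Taylor 1995 §2 says "suppose that if `ℓ = 3` then `ρ̄|_{ℚ(√-3)}` is absolutely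
irreducible" — Cor. 2.43 (`H⁰(ℚ, ad⁰ρ̄(1)) = 0`), Lemma 2.48 (`H¹(SL₂(𝔽₃), End⁰) = 0`, the case
`#F = 3` that [CPS] excludes and DDT "check directly"), Thm. 2.49 (Taylor–Wiles primes
`q ≡ 1 (3ⁿ)` with `ρ̄(Frob_q)` having distinct eigenvalues, and the fixed-line step of its proof) —
is a FINITE statement inside `GL₂(𝔽₃) ⋉ 𝔰𝔩₂(𝔽₃)` (order `48`, `9 ∤ 48`), because the stub's `ρ̄`
is `W[3]`, valued in `GL₂(𝔽₃)` on the nose.  This file kernel-decides those finite statements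
(§1, `decide +kernel`, the idiom of `DefiniteXiFreyModularityStubAbsIrrNegThreeGroup`) and types the
three Galois-level consequences the `R_Σ = T_Σ` seat (k2's F_BΣ / G1) will consume (§2, `sorry`,
each with its proof route over NAMED tree declarations; X5 and X7 are provable NOW).

§1 (PROVED, finite checks in `M₂(𝔽₃)`):
* X0 `quaternion_relations` — `i = (0 1; 2 0)`, `j = (1 1; 1 2)`, `k = ij`: `i² = j² = k² = -1`, `ij = -ji`.
* X1 `exists_sq_eq_neg_one_of_mul_ne` — two NON-COMMUTING elements of `SL₂(𝔽₃)` have one of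
  `A, B, AB, A²B` squaring to `-1` (a non-abelian subgroup of `SL₂(𝔽₃) ≅ Q₈ ⋊ C₃` contains the
  normal Sylow-2 `Q₈`; `{A, B, AB}` alone does NOT suffice — brute force, `bc/gl23_facts.py`).
* X1' `sq_eq_neg_one_iff` — in `SL₂(𝔽₃)` the solutions of `A² = -1` are exactly `±i, ±j, ±k`.
* X2 `trace_eq_zero_iff_sq_eq_neg_one`, `disc_ne_zero_iff_trace_eq_zero` — for `det A = 1`:
  `tr A = 0 ↔ A² = -1 ↔ tr² - 4 det ≠ 0` (distinct eigenvalues `±√-1 ∈ 𝔽₉ ∖ 𝔽₃`): at `ℓ = 3` a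
  Taylor–Wiles Frobenius (`q ≡ 1 (3)`, distinct eigenvalues) is EXACTLY one with `a_q ≡ 0 (3)`, and
  its eigenvalues never lie in `𝔽₃` (so the coefficient ring must contain `W(𝔽₉)`).
* X3 `sq_pow_three_pow` — `a² = -1 ⇒ (a^{3^m})² = -1` (any monoid with distributive negation).
* X4a `eq_zero_of_commute_quaternion` — a trace-zero matrix commuting with `i` and `j` is `0`
  (`(𝔰𝔩₂)^{Q₈} = 0`: the `ℓ = 3` content of DDT Cor. 2.43, `H⁰(ℚ, ad⁰ρ̄(1)) = 0`).
* X5k `exists_eq_conj_sub_of_norm_eq_zero` — for the transvection `σ = (1 1; 0 1)`: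
  `ker(1 + Ad σ + Ad σ²) = im(Ad σ - 1)` on `𝔰𝔩₂(𝔽₃)` (DDT Lemma 2.48, "`#F = 3`: one checks directly
  that `H¹(U, M) ≅ ker N/(σ-1)M = 0`").
* X6 `exists_conj_add_ne_zero` — every non-zero trace-zero `v` has `v + g v g⁻¹ ≠ 0` for some
  `g ∈ {i, j, k}` (the fixed-line step of DDT Thm. 2.49: a `g` of order prime to `3` fixing a
  non-zero vector of any non-zero `Q₈`-submodule of `ad⁰`).

§2 (TYPED, `sorry`, routes in docstrings):
* X4b `eq_zero_of_forall_conj_eq_cyclotomic_smul` — `H⁰(ℚ, ad⁰ρ̄(1)) = 0` for any `ρ̄ : Γ_ℚ → GL₂(𝔽₃)`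
  absolutely irreducible on `Γ_{ℚ(√-3)}` (M; Burnside/Schur).
* X4c `adZeroRep_invariants_eq_bot_of_mul_ne` — clause (ii) of `IsThorneAdequate` for every
  `G ≤ GL₂(𝔽₃)` containing two non-commuting elements of determinant `1` (S; X1 + X1' + X4a).
* X5 `adZeroRep_cocycles₁_le_coboundaries₁_gl2_three` — **`H¹(G, 𝔰𝔩₂(𝔽₃)) = 0` for EVERY
  `G ≤ GL₂(𝔽₃)`** (S; provable now: `9 ∤ 48`, tree `MonomialAdequacy.exists_eq_sub_of_subgroup` +
  Langlands-summit `adZeroRep_cocycles₁_le_coboundaries₁_of_card`, or X5k directly).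
* X7g `exists_sq_eq_neg_one_fixing_zeta` — a `τ ∈ Γ_ℚ` with `ρ̄(τ)² = -1` fixing `μ_{3ⁿ}` (M; X1 on
  the image of `Γ_{ℚ(√-3)}`, X3 cube trick, `modPCyclotomicCharacterZMod_spec`).
* X7 `exists_twPrime_three` — **Taylor–Wiles prime supply at `ℓ = 3`** for `ρ̄ = W[3]`: for all
  `n`, `S` finite there is a good prime `q ∉ S`, `q ≡ 1 (mod 3ⁿ)`, `3 ∣ a_q(W)` (M; X7g + tree
  Chebotarev `exists_isArithFrobAt_mul_inv_mem_not_mem` + `smul_eq_pow_of_isArithFrobAt_rat` +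
  `trace_galoisRepTorsion_frobenius_eq`).  = DDT Thm. 2.49 (a)(b) at `ℓ = 3`.
-/

set_option linter.dupNamespace false

noncomputable section

open scoped MatrixGroups NumberField
open Matrix Field IsDedekindDomain NumberField
open Literature.NumberTheory.EllipticCurves
open Literature.NumberTheory.Automorphic Literature.NumberTheory.Automorphic.BCDT
open Literature.NumberTheory.GaloisRepresentations
open WeierstrassCurve Rat.HeightOneSpectrum
open Summit.ABC.ABC.Theorems

namespace Summit.ABC.ABC.Cruxes.FreyModularity.StubIdeas3G4

/-- The stub `stub_liftThree` of `Lines/Sketch.lean`, verbatim (= `StubIdeas3.LiftThree`). -/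
def LiftThree : Prop :=
  ∀ (W : WeierstrassCurve ℚ) [W.IsElliptic] (ρ : ModPGaloisRep ℚ (ZMod 3) 2),
    W.IsTorsionGaloisRep 3 ρ → ρ.IsAbsIrreducibleOverSqrt (-3) → ¬ 9 ∣ W.conductorNorm ℤ →
      ρ.IsModular → W.IsModularGaloisRepTate 3

/-! ## §1. Kernel-decided facts in `GL₂(𝔽₃)` and `𝔰𝔩₂(𝔽₃)` -/

/-- `i ∈ Q₈ ⊂ SL₂(𝔽₃)`. -/
def qi : Matrix (Fin 2) (Fin 2) (ZMod 3) := !![0, 1; 2, 0]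
/-- `j ∈ Q₈ ⊂ SL₂(𝔽₃)`. -/
def qj : Matrix (Fin 2) (Fin 2) (ZMod 3) := !![1, 1; 1, 2]
/-- `k = i j ∈ Q₈ ⊂ SL₂(𝔽₃)`. -/
def qk : Matrix (Fin 2) (Fin 2) (ZMod 3) := !![1, 2; 2, 2]
/-- The transvection `σ = (1 1; 0 1)` generating the unipotent `U ≅ C₃` of DDT Lemma 2.48. -/
def σT : Matrix (Fin 2) (Fin 2) (ZMod 3) := !![1, 1; 0, 1]
/-- `σ⁻¹ = (1 2; 0 1)`. -/
def σTi : Matrix (Fin 2) (Fin 2) (ZMod 3) := !![1, 2; 0, 1]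

/-- **X0.** Quaternion relations in `SL₂(𝔽₃)`: `i² = j² = k² = -1`, `k = ij = -ji`, all of
determinant `1`; `σ σ⁻¹ = 1`, `σ³ = 1`. [folklore] -/
theorem quaternion_relations :
    qi * qi = -1 ∧ qj * qj = -1 ∧ qk * qk = -1 ∧ qi * qj = qk ∧ qi * qj = -(qj * qi) ∧
      qi.det = 1 ∧ qj.det = 1 ∧ qk.det = 1 ∧ σT * σTi = 1 ∧ σT * σT * σT = 1 ∧ σT.det = 1 := by
  simp only [qi, qj, qk, σT, σTi, Matrix.det_fin_two_of]
  decide +kernel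

set_option synthInstance.maxHeartbeats 400000 in
set_option synthInstance.maxSize 4096 in
/-- **X1. A non-abelian subgroup of `SL₂(𝔽₃)` contains an element of order `4`** — witnessed by an
inverse-free word: for non-commuting `A, B` of determinant `1`, one of `A, B, AB, A²B` squares to
`-1` (the family `{A, B, AB}` is not enough: `A = (0 1; 2 1)` of order `6`, `B = (1 0; 1 1)` of
order `3`, `AB` of order `3` — 96 such pairs).
Finite check over the `3⁸` pairs. [folklore] -/
theorem exists_sq_eq_neg_one_of_mul_ne (A B : Matrix (Fin 2) (Fin 2) (ZMod 3))
    (hA : A.det = 1) (hB : B.det = 1) (hAB : A * B ≠ B * A) :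
    A * A = -1 ∨ B * B = -1 ∨ (A * B) * (A * B) = -1 ∨ (A * A * B) * (A * A * B) = -1 := by
  obtain ⟨a, b, c, d, rfl⟩ : ∃ a b c d : ZMod 3, A = !![a, b; c, d] :=
    ⟨_, _, _, _, Matrix.eta_fin_two A⟩
  obtain ⟨p, q, r, s, rfl⟩ : ∃ p q r s : ZMod 3, B = !![p, q; r, s] :=
    ⟨_, _, _, _, Matrix.eta_fin_two B⟩
  rw [Matrix.det_fin_two_of] at hA hB
  revert p q r s
  revert a b c d
  decide +kernel

/-- **X1'. The elements of order `4` of `SL₂(𝔽₃)` are exactly `±i, ±j, ±k`** (they form, with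
`±1`, the normal Sylow `2`-subgroup `Q₈`). [folklore] -/
theorem sq_eq_neg_one_iff (A : Matrix (Fin 2) (Fin 2) (ZMod 3)) (hA : A.det = 1) :
    A * A = -1 ↔ (A = qi ∨ A = -qi ∨ A = qj ∨ A = -qj ∨ A = qk ∨ A = -qk) := by
  obtain ⟨a, b, c, d, rfl⟩ : ∃ a b c d : ZMod 3, A = !![a, b; c, d] :=
    ⟨_, _, _, _, Matrix.eta_fin_two A⟩
  rw [Matrix.det_fin_two_of] at hA
  simp only [qi, qj, qk]
  revert a b c d
  decide +kernel

/-- **X2. In `SL₂(𝔽₃)`: trace `0` ⟺ square `-1`.**  With X2' below: a Taylor–Wiles Frobenius at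
`ℓ = 3` (`det = q ≡ 1`, distinct eigenvalues) is exactly an element of order `4`, `a_q ≡ 0 (3)`.
[folklore] -/
theorem trace_eq_zero_iff_sq_eq_neg_one (A : Matrix (Fin 2) (Fin 2) (ZMod 3)) (hA : A.det = 1) :
    A.trace = 0 ↔ A * A = -1 := by
  obtain ⟨a, b, c, d, rfl⟩ : ∃ a b c d : ZMod 3, A = !![a, b; c, d] :=
    ⟨_, _, _, _, Matrix.eta_fin_two A⟩
  rw [Matrix.det_fin_two_of] at hA
  rw [Matrix.trace_fin_two_of]
  revert a b c d
  decide +kernel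

/-- **X2'. In `SL₂(𝔽₃)`: the discriminant `tr² - 4 det` of the characteristic polynomial is
non-zero (distinct eigenvalues, in `𝔽₉`) iff the trace is `0`** — and then `tr² - 4 det = -1` is a
non-square in `𝔽₃`, so the eigenvalues `±√-1` are NOT in `𝔽₃`. [folklore] -/
theorem disc_ne_zero_iff_trace_eq_zero (A : Matrix (Fin 2) (Fin 2) (ZMod 3)) (hA : A.det = 1) :
    A.trace ^ 2 - 4 * A.det ≠ 0 ↔ A.trace = 0 := by
  obtain ⟨a, b, c, d, rfl⟩ : ∃ a b c d : ZMod 3, A = !![a, b; c, d] :=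
    ⟨_, _, _, _, Matrix.eta_fin_two A⟩
  rw [Matrix.det_fin_two_of] at hA ⊢
  rw [Matrix.trace_fin_two_of]
  revert a b c d
  decide +kernel

/-- **X3. The cube trick**: `a² = -1 ⇒ (a^{3^m})² = -1` (`3^m` is odd).  Used with `a = ρ̄(τ)`:
`τ^{3^{n-1}}` still has image of order `4` but acts trivially on `μ_{3ⁿ}` when `τ` fixes `μ₃`.
[folklore] -/
theorem sq_pow_three_pow {R : Type*} [Monoid R] [HasDistribNeg R] {a : R} (h : a * a = -1)
    (m : ℕ) : a ^ 3 ^ m * a ^ 3 ^ m = -1 := by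
  rw [← pow_add, ← two_mul, pow_mul, sq, h]
  exact (Odd.pow (by decide : Odd 3)).neg_one_pow

/-- **X4a. `(𝔰𝔩₂(𝔽₃))^{Q₈} = 0`**: a trace-zero matrix commuting with `i` and `j` vanishes (the
three lines `𝔽₃ i, 𝔽₃ j, 𝔽₃ k` of `𝔰𝔩₂ = Q₈`-span are the three non-trivial characters of
`Q₈/{±1} = V₄`).  This is the `ℓ = 3` content of DDT Cor. 2.43: `H⁰(ℚ, ad⁰ρ̄(1))` consists of
trace-zero matrices commuting with `ρ̄(Γ_{ℚ(√-3)}) ⊇ Q₈`.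
[cite: DarmonDiamondTaylor1995, Cor. 2.43 (proof, first sentence)] -/
theorem eq_zero_of_commute_quaternion (v : Matrix (Fin 2) (Fin 2) (ZMod 3)) (hv : v.trace = 0)
    (hi : qi * v = v * qi) (hj : qj * v = v * qj) : v = 0 := by
  obtain ⟨a, b, c, d, rfl⟩ : ∃ a b c d : ZMod 3, v = !![a, b; c, d] :=
    ⟨_, _, _, _, Matrix.eta_fin_two v⟩
  rw [Matrix.trace_fin_two_of] at hv
  simp only [qi, qj] at hi hj
  revert a b c d
  decide +kernel

/-- **X5k. DDT Lemma 2.48 at `#F = 3`, the kernel**: on `M = 𝔰𝔩₂(𝔽₃)` with `U = ⟨σ⟩ ≅ C₃` acting by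
conjugation, `ker N = (σ - 1)M` for `N = 1 + σ + σ²`, i.e. `H¹(U, M) = 0` ("one checks directly").
The witness `m` is sought among trace-zero matrices `(p q; r -p)`.
[cite: DarmonDiamondTaylor1995, Lemma 2.48 (case #F = 3)] -/
theorem exists_eq_conj_sub_of_norm_eq_zero (x : Matrix (Fin 2) (Fin 2) (ZMod 3)) (hx : x.trace = 0)
    (hN : x + σT * x * σTi + σT * σT * x * (σTi * σTi) = 0) :
    ∃ p q r : ZMod 3, x = σT * !![p, q; r, -p] * σTi - !![p, q; r, -p] := by
  obtain ⟨a, b, c, d, rfl⟩ : ∃ a b c d : ZMod 3, x = !![a, b; c, d] :=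
    ⟨_, _, _, _, Matrix.eta_fin_two x⟩
  rw [Matrix.trace_fin_two_of] at hx
  simp only [σT, σTi] at hN ⊢
  revert a b c d
  decide +kernel

/-- **X6. The fixed-line step of DDT Thm. 2.49 at `ℓ = 3`**: for every non-zero trace-zero `v`
some `g ∈ {i, j, k}` (order `4`, prime to `3`; `g⁻¹ = -g`) has `v + g v g⁻¹ ≠ 0` — a non-zero
`g`-FIXED vector (`g² = -1` acts trivially on `ad⁰`) inside the `Q₈`-submodule generated by `v`.
[cite: DarmonDiamondTaylor1995, Thm. 2.49 (proof, last paragraph)] -/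
theorem exists_conj_add_ne_zero (v : Matrix (Fin 2) (Fin 2) (ZMod 3)) (hv : v.trace = 0)
    (h0 : v ≠ 0) :
    v + qi * v * (-qi) ≠ 0 ∨ v + qj * v * (-qj) ≠ 0 ∨ v + qk * v * (-qk) ≠ 0 := by
  obtain ⟨a, b, c, d, rfl⟩ : ∃ a b c d : ZMod 3, v = !![a, b; c, d] :=
    ⟨_, _, _, _, Matrix.eta_fin_two v⟩
  rw [Matrix.trace_fin_two_of] at hv
  simp only [qi, qj, qk]
  revert a b c d
  decide +kernel

/-! ## §2. The Galois-level consequences (typed; `sorry`; routes in the docstrings) -/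

/-- **X4b = DDT Cor. 2.43 at `ℓ = 3`: `H⁰(ℚ, ad⁰ρ̄(1)) = 0`.**  For `ρ̄ : Γ_ℚ → GL₂(𝔽₃)` with
`ρ̄|_{Γ_{ℚ(√-3)}}` absolutely irreducible, no non-zero trace-zero `v` satisfies
`ρ̄(γ) v = χ̄₃(γ) v ρ̄(γ)` for all `γ`.  Route (M): for `γ` in the image of `Γ_L → Γ_ℚ`, `L` a
splitting field of `X² + 3`, `χ̄₃(γ) = 1` (`modPCyclotomicCharacter_three_eq_one_of_mem_range`),
so `v` commutes with `ρ̄(Γ_L)`; absolute irreducibility of `restrictField L ρ̄` gives, by the tree's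
Burnside `span_eq_top_iff_forall_isIrreducible` (or Schur), that `v` is scalar; a trace-zero scalar
`2×2` matrix over `𝔽₃` is `0`.  Neither `W` nor `det ρ̄ = χ̄₃` is needed.
[cite: DarmonDiamondTaylor1995, Cor. 2.43] -/
theorem eq_zero_of_forall_conj_eq_cyclotomic_smul (ρ : ModPGaloisRep ℚ (ZMod 3) 2)
    (hirr : ρ.IsAbsIrreducibleOverSqrt (-3)) (v : Matrix (Fin 2) (Fin 2) (ZMod 3))
    (hv : v.trace = 0)
    (h : ∀ γ : absoluteGaloisGroup ℚ,
      ((ρ γ : GL (Fin 2) (ZMod 3)) : Matrix (Fin 2) (Fin 2) (ZMod 3)) * v =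
        ((modPCyclotomicCharacterZMod ℚ 3 γ : (ZMod 3)ˣ) : ZMod 3) •
          (v * ((ρ γ : GL (Fin 2) (ZMod 3)) : Matrix (Fin 2) (Fin 2) (ZMod 3)))) :
    v = 0 := by
  sorry

/-- **X4c. Clause (ii) of `IsThorneAdequate` for subgroups of `GL₂(𝔽₃)` meeting `SL₂(𝔽₃)`
non-abelianly**: if `G ≤ GL₂(𝔽₃)` contains two non-commuting elements of determinant `1` then
`(ad⁰)^G = 0`.  Route (S, from §1): X1 gives an element of order `4` among `A, B, AB, A²B ∈ G`;
conjugating it by the other generator gives a second, non-commuting one (both in `{±i, ±j, ±k}` by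
X1'); an invariant trace-zero matrix commutes with two distinct quaternion axes, hence is `0` (X4a,
up to the automorphisms of `Q₈` permuting `i, j, k` — or re-run X4a's `decide` for each pair).
[folklore] -/
theorem adZeroRep_invariants_eq_bot_of_mul_ne (G : Subgroup (GL (Fin 2) (ZMod 3)))
    {A B : GL (Fin 2) (ZMod 3)} (hA : A ∈ G) (hB : B ∈ G)
    (hdA : (A : Matrix (Fin 2) (Fin 2) (ZMod 3)).det = 1)
    (hdB : (B : Matrix (Fin 2) (Fin 2) (ZMod 3)).det = 1) (hAB : A * B ≠ B * A) :
    (Literature.NumberTheory.GaloisRepresentations.Subgroup.adZeroRep G).invariants = ⊥ := by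
  sorry

/-- **X5 = DDT Lemma 2.48 at `#F = 3`, uniformly: `H¹(G, 𝔰𝔩₂(𝔽₃)) = 0` for EVERY subgroup
`G ≤ GL₂(𝔽₃)`** (clause (iii) of `IsThorneAdequate` over `k = 𝔽₃`).  Route (S, provable now):
`|GL₂(𝔽₃)| = 48`, so `9 ∤ |G|`.  If `3 ∤ |G|`, restriction to `K = ⊥` (index `|G| ≠ 0` in `𝔽₃`)
reflects coboundaries: tree `MonomialAdequacy.exists_eq_sub_of_subgroup` (`AdequacyDegreeP`) with
`cocycles₁_le_coboundaries₁_iff_forall` (`ExtendedAdequateSubgroup`).  If `3 ∣ |G|`, Cauchy gives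
`u ∈ G` of order `3` and the Langlands-summit helper
`Summit.Langlands…CoreAdequacy.NoAdequateLayer.adZeroRep_cocycles₁_le_coboundaries₁_of_card`
(`CoreAdequacySplitNoAdequateLayerLiftingSylowThree.lean`, PROVED, any `char k = 3`) concludes —
request its promotion to `Literature/RepresentationTheory/FiniteGroups/` rather than importing
across summits, or re-prove its 40 lines with X5k as the `⟨u⟩`-step.  The TWISTED module
`ad⁰ ⊗ det` needed in Thm. 2.49 (c) (`ad⁰ρ̄(1)` on `Gal(F₀/ℚ) = PGL₂(𝔽₃) ≅ S₄`, `χ̄₃ = sign`)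
reduces to this over `G ∩ SL₂(𝔽₃)` (index `≤ 2`) by the same coset averaging; brute force confirms
`H¹(GL₂(𝔽₃), 𝔰𝔩₂ ⊗ det) = 0` (`bc/gl23_facts.py`).
[cite: DarmonDiamondTaylor1995, Lemma 2.48] -/
theorem adZeroRep_cocycles₁_le_coboundaries₁_gl2_three (G : Subgroup (GL (Fin 2) (ZMod 3))) :
    groupCohomology.cocycles₁
        (Rep.of (Literature.NumberTheory.GaloisRepresentations.Subgroup.adZeroRep G)) ≤
      groupCohomology.coboundaries₁
        (Rep.of (Literature.NumberTheory.GaloisRepresentations.Subgroup.adZeroRep G)) := by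
  sorry

/-- **X7g. The group-theoretic half of the Taylor–Wiles prime supply at `ℓ = 3`.**  If
`ρ̄ = W[3]` and `ρ̄|_{ℚ(√-3)}` is absolutely irreducible then for every `n` some `τ ∈ Γ_ℚ` has
`ρ̄(τ)² = -1` and fixes every `3ⁿ`-th root of unity.  Route (M): the image of `Γ_L`
(`L = ℚ(√-3) = ℚ(ζ₃)`) lies in `SL₂(𝔽₃)` (`det ρ̄ = χ̄₃`:
`det_eq_modPCyclotomicCharacter_of_isTorsionGaloisRep_holds` + `modPCyclotomicCharacter_three_eq_one_of_mem_range`)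
and is non-abelian (absolutely irreducible, `IsAbsIrreducibleOverSqrt`), so X1 yields `τ₀ ∈ Γ_L`
with `ρ̄(τ₀)² = -1`; `τ₀` fixes `ζ₃`, hence acts on a primitive `ζ_{3ⁿ}` by `ζ ↦ ζ^c`, `c ≡ 1 (3)`
(`modPCyclotomicCharacterZMod_spec` at level `3ⁿ` / `IsPrimitiveRoot.autToPow`), and
`τ = τ₀^{3^{n-1}}` works: `c^{3^{n-1}} ≡ 1 (3ⁿ)` and `ρ̄(τ)² = -1` by X3.
[cite: DarmonDiamondTaylor1995, Thm. 2.49 (a)(b)] -/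
theorem exists_sq_eq_neg_one_fixing_zeta (W : WeierstrassCurve ℚ) [W.IsElliptic]
    {ρ : ModPGaloisRep ℚ (ZMod 3) 2} (hρ : W.IsTorsionGaloisRep 3 ρ)
    (hirr : ρ.IsAbsIrreducibleOverSqrt (-3)) (n : ℕ) :
    ∃ τ : absoluteGaloisGroup ℚ,
      ((ρ τ : GL (Fin 2) (ZMod 3)) : Matrix (Fin 2) (Fin 2) (ZMod 3)) *
          ((ρ τ : GL (Fin 2) (ZMod 3)) : Matrix (Fin 2) (Fin 2) (ZMod 3)) = -1 ∧
        ∀ ζ : AlgebraicClosure ℚ, ζ ^ 3 ^ n = 1 → τ • ζ = ζ := by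
  sorry

/-- **X7. Taylor–Wiles prime supply at `ℓ = 3` (DDT Thm. 2.49 (a)(b) for `ρ̄ = W[3]`).**  If
`W[3]|_{ℚ(√-3)}` is absolutely irreducible then for every `n` and every finite set `S` of primes
there is a prime `q ∉ S` of good reduction with `q ≡ 1 (mod 3ⁿ)` and `3 ∣ a_q(W)` — i.e. (X2, X2')
`ρ̄(Frob_q)` has determinant `1`, order `4` and distinct eigenvalues `±√-1 ∈ 𝔽₉`.  Route (M,
provable now): X7g gives `τ`; `N = ker ρ̄ ⊓ Γ_{ℚ(μ_{3ⁿ})}` is an open normal subgroup (continuity of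
`ρ̄` into discrete `GL₂(𝔽₃)`; `IntermediateField.fixingSubgroup_isOpen`), so the tree's Chebotarev
`exists_isArithFrobAt_mul_inv_mem_not_mem ℚ N τ S'` (with `S' = S ∪ {2, 3} ∪ bad primes`) gives a
place `q` and an arithmetic Frobenius `φ` with `φ τ⁻¹ ∈ N`; then `ρ̄(φ) = ρ̄(τ)`, so
`a_q ≡ tr ρ̄(φ) = 0 (mod 3)` (`trace_galoisRepTorsion_frobenius_eq`, X2,
`LFunction_apply_prime_eq_frobeniusTrace`), and `φ ζ = ζ^q` on `μ_{3ⁿ}`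
(`smul_eq_pow_of_isArithFrobAt_rat`) with `φ ζ = τ ζ = ζ` forces `3ⁿ ∣ q - 1`
(`IsPrimitiveRoot.pow_eq_one_iff_dvd`).
[cite: DarmonDiamondTaylor1995, Thm. 2.49 (a)(b)] -/
theorem exists_twPrime_three (W : WeierstrassCurve ℚ) [W.IsElliptic]
    {ρ : ModPGaloisRep ℚ (ZMod 3) 2} (hρ : W.IsTorsionGaloisRep 3 ρ)
    (hirr : ρ.IsAbsIrreducibleOverSqrt (-3)) (n : ℕ) (S : Finset ℕ) :
    ∃ (q : ℕ) (_ : Fact q.Prime), q ∉ S ∧ q ≠ 3 ∧ q ≡ 1 [MOD 3 ^ n] ∧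
      W.HasGoodReductionAtPrime q ∧ (3 : ℤ) ∣ W.LFunction q := by
  sorry

end Summit.ABC.ABC.Cruxes.FreyModularity.StubIdeas3G4

end
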